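import Summits.BirchSwinnertonDyer.BirchSwinnertonDyer.Theorems.PrintCf2RubinValueTwoTwistedZetaFamily
import Literature.NumberTheory.ComplexMultiplication.EllipticUnits.ImaginaryQuadraticMainConjectureCarriersGroupElt
import Literature.NumberTheory.ComplexMultiplication.EllipticUnits.ImaginaryQuadraticMainConjectureCarriersExist
import HarnessLib

/-!
# F0b (zeta pins of `JohnsonLeungKings2011.TwistedIwasawaData`), FILE 5: EXISTENCE OF THE PINNED DATUM —
# `Nonempty (JohnsonLeungKings2011.TwistedIwasawaData p κ₁ κ₂ γ₁ γ₂ θ 𝔣 ι)` with PRESCRIBED carriers, conditional on the prints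
# (E) Kato §15.5, (O1) de Shalit II.2.5 (i) + II.2.4 (i), (O2) de Shalit II.2.4 (ii)

Cell `bsd-print-cf2`, WIDTH seat `bsd-line-cf2-p1-w5` g10 (prover-bsd-line-cf2-p1-w5-g10-0); construction F0b of route C
(`PrintCf2RubinValueTwo`), plan `HOME/bsd-line-cf2-p1-w5/F0B-ASSEMBLY-PLAN-w5g9.md` step 6; `--supports` the deciding child
stmt-BirchSwinnertonDyer-24721 (helper, Theses-free). THEOREMS ONLY (no definition, no named fact, no instance, no `sorry`). The four prints
enter ONLY as displayed hypotheses — the tree's named facts `Kato2004.sec155_exists_katoUnitRep` (ty2 g38), `DeShalit1987.prop24_i_mem_rayClassField`,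
`DeShalit1987.prop24_ii_galoisAction`, `DeShalit1987.prop25_i_normRelation` (statement-only `def … : Prop`, PUBLISHED results). HONEST FRAMING: this
is the EXISTENCE of ty2 g37's pinned datum (the cell's construction (M1)/F0b, §5 of `ImaginaryQuadraticMainConjectureCarriers.lean`), CONDITIONAL on
those prints; it does not prove [JLK] Cor. 5.3 (`cor53_thm52Shape`, which stays a named fact), it does not close the crux, no summit statement is
proved by this seat, and BSD is not proved by any of this.

WHAT.
* `pairLayerSubgroup_unitTwist` — the layers of a pair of `ℤ_p`-extensions do not see unit twists (so (A1) at a pair UP TO UNITS is -w2 g17's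
  `exists_artin_exponents`);
* **`exists_twistedIwasawaData`** — for `K` imaginary quadratic, `ι`, `p`, a generator pair `(γ₁, γ₂)` of `Gal(K̃_∞/K)` UP TO UNITS, `θ` trivial
  on `Gal(K̄/K(𝔣))`, `𝔣 ≠ 0`, and ANY three carriers `I0, I1, I2 : IwasawaCohomologyData …` (e.g. -w5 g9's `iwasawaCohomologyData`, item 24745):
  `∃ D : TwistedIwasawaData p κ₁ κ₂ γ₁ γ₂ θ 𝔣 ι, D.D0 = I0 ∧ D.D1 = I1 ∧ D.D2 = I2`. The pins: (A1) = `exists_artin_exponents`; `aZeta a` = the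
  element of `I1.H = lim←_{n,k}` given by the compatible zeta family of FILE 4 ((P4)); (Z1) = FILE 4 (ii); (Z2) = `proj`-wise (P3): at a common large
  Kato level `s`, ty2's `proj_nsubElt_smul` (-w5 g9) + `relCores_levelConj` reduce it to FILE 3's `indep_at_katoLevel`;
* **`nonempty_twistedIwasawaData`**, **`twistedIwasawaDataExists_of_prints`** — the closed `∀`-form, the text of route C's support item F0b
  (`TwistedIwasawaDataExistsOfPrints`).

References: J. Johnson-Leung, G. Kings, J. reine angew. Math. 653 (2011) = arXiv:0804.2828, Def. 3.2, Prop. 3.3, §3.3 (5)–(6), Def. 3.5,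
§4.2 Def. 4.2 (94), §5.1–5.2, Cor. 5.3; K. Kato, Astérisque 295 (2004) §15.5–15.6; A. Burungale, M. Flach (2024) §3.2, §4.1 Lemma 7; E. de Shalit
(1987) II.2.4–II.2.5.
-/

noncomputable section

open scoped Classical

-- the summit namespace `Summit.BirchSwinnertonDyer.BirchSwinnertonDyer` repeats the problem name by design (D-0017)
set_option linter.dupNamespace false
set_option autoImplicit false

open scoped NumberField
open Field IsDedekindDomain
open Literature.NumberTheory.NumberFields (rayClassField)
open Literature.NumberTheory.GaloisRepresentations Literature.NumberTheory.GaloisRepresentations.DiscreteGaloisModule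
open Literature.NumberTheory.EllipticCurves (IsImaginaryQuadratic ZpExtension)
open Literature.NumberTheory.ComplexMultiplication.EllipticUnits
open Literature.NumberTheory.ComplexMultiplication.EllipticUnits.JohnsonLeungKings2011
open Summit.BirchSwinnertonDyer.BirchSwinnertonDyer.Theorems.PrintCf2.RelCoresTower

namespace Summit.BirchSwinnertonDyer.BirchSwinnertonDyer.Theorems.PrintCf2.TwistedZeta

variable {K : Type} [Field K] [NumberField K] (p : ℕ) [Fact p.Prime] (θ : absoluteGaloisGroup K →ₜ* ℤ_[p]ˣ)
  (𝔣 : Ideal (𝓞 K)) {κ₁ κ₂ : ZpExtension K p} {γ₁ γ₂ : absoluteGaloisGroup K}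

omit [NumberField K] in
/-- The layer groups `Gal(K̄/K̃_n)` of a pair of `ℤ_p`-extensions are unchanged by unit twists. [cite: JohnsonLeungKings2011, §4.1 (arXiv p0012:L7–14)] -/
theorem pairLayerSubgroup_unitTwist (κ₁ κ₂ : ZpExtension K p) (u₁ u₂ : ℤ_[p]ˣ) (n : ℕ) :
    JohnsonLeungKings2011.pairLayerSubgroup (κ₁.unitTwist u₁) (κ₂.unitTwist u₂) n =
      JohnsonLeungKings2011.pairLayerSubgroup κ₁ κ₂ n := by
  change (κ₁.unitTwist u₁).layerSubgroup n ⊓ (κ₂.unitTwist u₂).layerSubgroup n = κ₁.layerSubgroup n ⊓ κ₂.layerSubgroup n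
  rw [ZpExtension.layerSubgroup_unitTwist, ZpExtension.layerSubgroup_unitTwist]

/-- **(A1) at a generator pair UP TO UNITS**: exponent maps with ty2's `artin_spec` VERBATIM for `(κ₁, κ₂; γ₁, γ₂)` whenever `(γ₁, γ₂)` is a
topological generator pair for some unit twists of `(κ₁, κ₂)` (the hypothesis shape of `cor53_thm52Shape`). [cite: JohnsonLeungKings2011, §5.1 (arXiv p0014:L12–14)] [cite: Kato2004Asterisque, §15.6 (p. 254)] -/
theorem exists_artin_exponents_of_unitTwist (h𝔣 : 𝔣 ≠ ⊥)
    (hγ : ∃ u₁ u₂ : ℤ_[p]ˣ, ZpExtension.IsTopGeneratorPair (κ₁.unitTwist u₁) (κ₂.unitTwist u₂) γ₁ γ₂) :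
    ∃ artin₁ artin₂ : AuxIdeals p 𝔣 → ℤ_[p], ∀ (a : AuxIdeals p 𝔣) (n : ℕ), ∃ s₀ : ℕ, ∀ s : ℕ, s₀ ≤ s →
      katoLevelSubgroup p 𝔣 s ≤ JohnsonLeungKings2011.pairLayerSubgroup κ₁ κ₂ n →
        γ₁ ^ (PadicInt.toZModPow n (artin₁ a)).val * γ₂ ^ (PadicInt.toZModPow n (artin₂ a)).val *
            (layerArtin p 𝔣 s a.1)⁻¹ ∈ JohnsonLeungKings2011.pairLayerSubgroup κ₁ κ₂ n := by
  obtain ⟨u₁, u₂, hγ⟩ := hγ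
  have h := exists_artin_exponents (p := p) h𝔣 hγ
  simp only [pairLayerSubgroup_unitTwist] at h
  exact h

/-- **EXISTENCE OF THE PINNED DATUM WITH PRESCRIBED CARRIERS** (the cell's construction F0b): for `K` imaginary quadratic, `ι : K → ℂ`, `p` prime,
`(γ₁, γ₂)` a topological generator pair of `Gal(K̃_∞/K)` up to units, `𝔣 ≠ 0`, `θ : Γ_K → ℤ_p^×` trivial on `Gal(K̄/K(𝔣))`, and ANY pinned carriers
`I0, I1, I2` (`H⁰, H¹, H²` of [JLK] Def. 4.2 (94) / Cor. 5.3 with their `Λ₂`-structure), there is a `TwistedIwasawaData` with exactly these carriers —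
CONDITIONAL on the prints (E) Kato §15.5 (`Kato2004.sec155_exists_katoUnitRep`), (O1) de Shalit II.2.5 (i) / II.2.4 (i), (O2) de Shalit II.2.4 (ii).
Pins: (A1) Kato's lifted Artin symbols have `p`-adic `(γ₁, γ₂)`-coordinates (-w2 g17); `aZeta a` = the compatible family
`(cor_{K(p^s𝔣)/K̃_n}(Kummer_k(ζ_{p^s𝔣}) ⊗ t_p(θ)))_{n,k}` of FILE 4 read in `I1.H = lim←` ((P4)); (Z1) by construction; (Z2) `(N𝔟 − σ_𝔟)·_𝔞ζ =
(N𝔞 − σ_𝔞)·_𝔟ζ` checked `proj`-wise ((P3)) at a common large Kato level via `proj_nsubElt_smul`, `relCores_levelConj` and FILE 3's `indep_at_katoLevel`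
(de Shalit II.2.4 (ii) through Kato's representatives, the θ-scalar conjugation law, the twelfth-root slack).
[cite: JohnsonLeungKings2011, Def. 3.2, Prop. 3.3 (2)(3), Def. 3.5, §4.2 Def. 4.2 (94), §5.1–5.2 (arXiv p0009:L55–95, p0010:L55–80, p0012:L80–112, p0014:L12–112)] [cite: Kato2004Asterisque, §15.5 (p. 253), §15.6 (p. 254)] [cite: BurungaleFlach2024, §3.2 and §4.1 Lemma 7 (arXiv p0013:L30–36, p0017:L50–68)] [cite: deShalit1987, II.2.4 Proposition, II.2.5 Proposition] -/
theorem exists_twistedIwasawaData (hE : Kato2004.sec155_exists_katoUnitRep) (h24i : DeShalit1987.prop24_i_mem_rayClassField)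
    (h24ii : DeShalit1987.prop24_ii_galoisAction) (h25 : DeShalit1987.prop25_i_normRelation) (hK : IsImaginaryQuadratic K)
    (ι : K →+* ℂ) (hγ : ∃ u₁ u₂ : ℤ_[p]ˣ, ZpExtension.IsTopGeneratorPair (κ₁.unitTwist u₁) (κ₂.unitTwist u₂) γ₁ γ₂) (h𝔣 : 𝔣 ≠ ⊥)
    (hθ𝔣 : ∀ σ ∈ absGaloisFixingSubgroup (rayClassField K 𝔣), θ σ = 1) (I0 : IwasawaCohomologyData p κ₁ κ₂ γ₁ γ₂ θ 𝔣 0)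
    (I1 : IwasawaCohomologyData p κ₁ κ₂ γ₁ γ₂ θ 𝔣 1) (I2 : IwasawaCohomologyData p κ₁ κ₂ γ₁ γ₂ θ 𝔣 2) :
    ∃ D : TwistedIwasawaData p κ₁ κ₂ γ₁ γ₂ θ 𝔣 ι, D.D0 = I0 ∧ D.D1 = I1 ∧ D.D2 = I2 := by
  haveI : NumberField.IsTotallyComplex K := hK.2
  -- (A1)
  obtain ⟨x₁, x₂, hart⟩ := exists_artin_exponents_of_unitTwist p 𝔣 h𝔣 hγ
  -- the zeta family and its system of representatives, roots and classes
  obtain ⟨s₀, u, β, c, y, hs₀, hu, hβ, hc, hy, hyc⟩ := exists_zetaFamily p θ 𝔣 κ₁ κ₂ hE h25 h24i hK ι h𝔣 hθ𝔣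
  -- `_𝔞ζ ∈ H¹ = lim←` ((P4))
  choose z hz using fun a ↦ I1.proj_surjective (y a) (hy a)
  refine ⟨
    { D0 := I0, D1 := I1, D2 := I2, artin₁ := x₁, artin₂ := x₂, artin_spec := hart, aZeta := z
      aZeta_proj := fun a n k ↦ ?_
      aZeta_indep := fun a b ↦ ?_ }, rfl, rfl, rfl⟩
  · -- (Z1)
    refine ⟨max s₀ (k + 2), fun s hs hle ↦ ⟨u a s, β a s k, c a s k, hu a s (le_of_max_le_left hs), hβ a s k, hc a s k, ?_⟩⟩
    rw [hz]
    exact hyc a n k s (le_of_max_le_left hs) (le_of_max_le_right hs) hle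
  · -- (Z2), `proj`-wise ((P3))
    refine I1.proj_eq_iff.mp fun n k ↦ ?_
    obtain ⟨sa, hsa⟩ := hart a n
    obtain ⟨sb, hsb⟩ := hart b n
    obtain ⟨sL, hsL⟩ := exists_katoLevelSubgroup_le_pairLayerSubgroup 𝔣 h𝔣 κ₁ κ₂ n
    -- a common large Kato level
    obtain ⟨s, hsas, hsbs, hsLs, hs0, hk2⟩ : ∃ s, sa ≤ s ∧ sb ≤ s ∧ sL ≤ s ∧ s₀ ≤ s ∧ k + 2 ≤ s :=
      ⟨sa + sb + sL + s₀ + k + 2, by omega, by omega, by omega, by omega, by omega⟩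
    have hs1 : 1 ≤ s := hs₀.trans hs0
    have hle : katoLevelSubgroup p 𝔣 s ≤ JohnsonLeungKings2011.pairLayerSubgroup κ₁ κ₂ n :=
      (katoLevelSubgroup_antitone p 𝔣 h𝔣 hsLs).trans hsL
    rw [I1.proj_nsubElt_smul one_le_two b (hsb s hsbs hle) k (z a), I1.proj_nsubElt_smul one_le_two a (hsa s hsas hle) k (z b),
      hz, hz, hyc a n k s hs0 hk2 hle, hyc b n k s hs0 hk2 hle]
    -- push the identity down to the Kato level `U_s`
    have push : ∀ (m t : ℤ) (γ : absoluteGaloisGroup K) (cc : levelCoh p (suppPF p 𝔣) θ (katoLevelSubgroup p 𝔣 s) k 1),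
        m • relCores p (suppPF p 𝔣) θ hle (JohnsonLeungKings2011.isOpen_pairLayerSubgroup κ₁ κ₂ n)
              (isOpen_absGaloisFixingSubgroup K (katoLayer p 𝔣 s)) k 1 cc -
          t • layerConj p κ₁ κ₂ θ 𝔣 n k 1 γ (relCores p (suppPF p 𝔣) θ hle (JohnsonLeungKings2011.isOpen_pairLayerSubgroup κ₁ κ₂ n)
              (isOpen_absGaloisFixingSubgroup K (katoLayer p 𝔣 s)) k 1 cc) =
          relCores p (suppPF p 𝔣) θ hle (JohnsonLeungKings2011.isOpen_pairLayerSubgroup κ₁ κ₂ n)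
              (isOpen_absGaloisFixingSubgroup K (katoLayer p 𝔣 s)) k 1
            (m • cc - t • levelConj p (suppPF p 𝔣) θ (katoLevelSubgroup p 𝔣 s) k 1 γ cc) := by
      intro m t γ cc
      rw [map_sub, map_zsmul, map_zsmul, relCores_levelConj]
      rfl
    rw [push, push]
    exact congrArg _ (indep_at_katoLevel p θ 𝔣 h24ii hK ι h𝔣 hθ𝔣 hs1 hk2 a b (hu a s hs0) (hu b s hs0) (hβ a s k) (hβ b s k)
      (hc a s k) (hc b s k))

/-- **`Nonempty (TwistedIwasawaData p κ₁ κ₂ γ₁ γ₂ θ 𝔣 ι)`** under the same hypotheses, with -w5 g9's constructed carriers `iwasawaCohomologyData`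
(item 24745 `IwasawaCohomologyDataExists`). [cite: JohnsonLeungKings2011, §4.2 Def. 4.2 (94) and §5.1–5.2 (arXiv p0012:L80–112, p0014:L12–112)] [cite: Kato2004Asterisque, §15.5 (p. 253)] -/
theorem nonempty_twistedIwasawaData (hE : Kato2004.sec155_exists_katoUnitRep) (h24i : DeShalit1987.prop24_i_mem_rayClassField)
    (h24ii : DeShalit1987.prop24_ii_galoisAction) (h25 : DeShalit1987.prop25_i_normRelation) (hK : IsImaginaryQuadratic K)
    (ι : K →+* ℂ) (hγ : ∃ u₁ u₂ : ℤ_[p]ˣ, ZpExtension.IsTopGeneratorPair (κ₁.unitTwist u₁) (κ₂.unitTwist u₂) γ₁ γ₂) (h𝔣 : 𝔣 ≠ ⊥)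
    (hθ𝔣 : ∀ σ ∈ absGaloisFixingSubgroup (rayClassField K 𝔣), θ σ = 1) :
    Nonempty (TwistedIwasawaData p κ₁ κ₂ γ₁ γ₂ θ 𝔣 ι) := by
  obtain ⟨D, -⟩ := exists_twistedIwasawaData p θ 𝔣 hE h24i h24ii h25 hK ι hγ h𝔣 hθ𝔣
    (iwasawaCohomologyData p κ₁ κ₂ γ₁ γ₂ θ 𝔣 (Nat.zero_le 2)) (iwasawaCohomologyData p κ₁ κ₂ γ₁ γ₂ θ 𝔣 one_le_two)
    (iwasawaCohomologyData p κ₁ κ₂ γ₁ γ₂ θ 𝔣 le_rfl)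
  exact ⟨D⟩

/-- **F0b — `TwistedIwasawaDataExistsOfPrints`, the closed form** (the text of route C's support item): the prints (E) Kato §15.5, (O1) de Shalit
II.2.4 (i) / II.2.5 (i), (O2) de Shalit II.2.4 (ii) — the tree's named facts, as hypotheses — imply, for every imaginary quadratic `K`, `p`,
pair `(κ₁, κ₂)`, generator pair `(γ₁, γ₂)` up to units, `θ` trivial on `Gal(K̄/K(𝔣))`, `𝔣 ≠ 0` and `ι`, that ty2's pinned datum of [JLK] Cor. 5.3
EXISTS. (Cor. 5.3 itself, `cor53_thm52Shape`, remains a named fact; nothing about BSD is proved.)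
[cite: JohnsonLeungKings2011, Def. 3.2, Prop. 3.3, Def. 3.5, Def. 4.2 (94), §5.1–5.2, Cor. 5.3 (arXiv p0009:L55–95, p0010:L55–80, p0012:L80–112, p0014:L12–112, p0015:L1–20)] [cite: Kato2004Asterisque, §15.5 (p. 253), §15.6 (p. 254)] [cite: deShalit1987, II.2.4 Proposition, II.2.5 Proposition] -/
theorem twistedIwasawaDataExists_of_prints (hE : Kato2004.sec155_exists_katoUnitRep)
    (h24i : DeShalit1987.prop24_i_mem_rayClassField) (h24ii : DeShalit1987.prop24_ii_galoisAction)
    (h25 : DeShalit1987.prop25_i_normRelation) :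
    ∀ (K : Type) [Field K] [NumberField K] (p : ℕ) [Fact p.Prime] (κ₁ κ₂ : ZpExtension K p)
      (γ₁ γ₂ : absoluteGaloisGroup K) (θ : absoluteGaloisGroup K →ₜ* ℤ_[p]ˣ) (𝔣 : Ideal (𝓞 K)) (ι : K →+* ℂ),
      IsImaginaryQuadratic K →
      (∃ u₁ u₂ : ℤ_[p]ˣ, ZpExtension.IsTopGeneratorPair (κ₁.unitTwist u₁) (κ₂.unitTwist u₂) γ₁ γ₂) →
      𝔣 ≠ ⊥ → (∀ σ ∈ absGaloisFixingSubgroup (rayClassField K 𝔣), θ σ = 1) →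
        Nonempty (TwistedIwasawaData p κ₁ κ₂ γ₁ γ₂ θ 𝔣 ι) :=
  fun _ _ _ p _ _ _ _ _ θ 𝔣 ι hK hγ h𝔣 hθ𝔣 ↦ nonempty_twistedIwasawaData p θ 𝔣 hE h24i h24ii h25 hK ι hγ h𝔣 hθ𝔣

end Summit.BirchSwinnertonDyer.BirchSwinnertonDyer.Theorems.PrintCf2.TwistedZeta

end
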